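import Literature.Probability.RandomPlanarGeometry.SAWTriangularEndpointEnvelope
import Literature.Probability.RandomPlanarGeometry.SAWOneStepRateInsertionEngine
import Literature.Probability.RandomPlanarGeometry.SAWTriangularHammersleyWelsh
import HarnessLib

/-!
# Kesten's mixed rate for walks of `𝕋` with a fixed endpoint: `−K N^{-1/3} ≤ c_{N+1}(0,x)/c_N(0,x) − μ(𝕋) ≤ K N^{-1/4}`

Topic `Literature/Probability/RandomPlanarGeometry` (lane «pcv-sawmu», item «TRI-ENDPOINT» rate; continues
`SAWTriangularEndpointEnvelope.lean` with the abstract engine `SAWOneStepRateInsertionEngine.lean`; assembly text: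
a-idea-1 gen 13, `Sketch_G13_R83.lean` §3–§4, specialised to the tree).  Source: N. Madras, G. Slade, *The Self-Avoiding
Walk* (1993), §7.5 eq. (7.5.2) p. 255: on `ℤ^d`, for `x ≠ 0` fixed, `−K N^{-1/3} < c_{N+2}(0,x)/c_N(0,x) − μ² < K N^{-1/4}`
(Kesten 1963; two steps, parity of `‖x‖₁`; the tree has it as `Zd.Kesten1963_ratioRate_endpoint_allDim`).  On `𝕋` (one
step, no parity) this file proves the same pair of exponents CONDITIONALLY on the single combinatorial input
`TriEndpointIns x` (the polygon insertion `c_n(0,x) t_m ≤ Z (n+m+k)^6 c_{n+m+k}(0,x)`, taken verbatim as a hypothesis):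
every other input of the engine is discharged by name — monotonicity `exists_card_triSLx_le_four_mul`
(`SAWTriangularEndpointMonotone`), Kesten's inequality and the lower envelope from the insertion
(`kestenIneqTriEndpoint_of`, `triEndpointLo_of_ins`), the Hammersley–Welsh upper envelope `triSawCount_le_exp_mul_pow`,
and the polygon envelope `abs_log_triLoopCount_sub_le` (`SAWTriangularPolygonGrowth`).

## Main statements (namespace `Literature.Probability.RandomPlanarGeometry.SAW`)

* `TriEndpointRate.triLoopCount_envelope`, `stem_lower`, `stem_ins` — the auxiliary sequence `T_m := μ^k t_{m−k}`;
* **`triEndpointRatioRateMixed_of_ins`** — `TriEndpointIns x → (−K N^{-1/3} ≤ φ_N(x) − μ(𝕋) ≤ K N^{-1/4}, N ≥ N₀)`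
  for `x ≠ 0` (the lane's face `TriEndpointRatioRateMixed x`);
* `abs_card_triSLx_ratio_sub_le_eventually_of_ins` — the symmetric `∀ᶠ` corollary with exponent `1/4`.
-/

noncomputable section

open Filter Topology Finset Literature.Probability.LatticeModels Literature.Probability.Percolation SimpleGraph

namespace Literature.Probability.RandomPlanarGeometry.SAW

namespace TriEndpointRate

/-- The two-sided envelope of `t_n`, exponentiated: `e^{−(53+3L)√n} μ^n ≤ t_n ≤ e^{(53+3L)√n} μ^n` for `n ≥ 4`
(`L = log μ(𝕋)`). [cite: MadrasSlade1993, Corollary 3.2.5 (3.2.9) (p. 67)] -/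
theorem triLoopCount_envelope {n : ℕ} (hn : 4 ≤ n) :
    Real.exp (-((53 + 3 * logMuTri) * Real.sqrt n)) * Real.exp logMuTri ^ n ≤ (triLoopCount n : ℝ) ∧
      (triLoopCount n : ℝ) ≤ Real.exp ((53 + 3 * logMuTri) * Real.sqrt n) * Real.exp logMuTri ^ n := by
  obtain ⟨ht0, hb⟩ := abs_log_triLoopCount_sub_le hn
  obtain ⟨h1, h2⟩ := abs_le.1 hb
  have hμ0 : 0 < Real.exp logMuTri := Real.exp_pos _
  constructor
  · refine (Real.log_le_log_iff (by positivity) ht0).1 ?_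
    rw [Real.log_mul (Real.exp_pos _).ne' (pow_pos hμ0 _).ne', Real.log_exp, Real.log_pow, Real.log_exp]
    linarith
  · refine (Real.log_le_log_iff ht0 (by positivity)).1 ?_
    rw [Real.log_mul (Real.exp_pos _).ne' (pow_pos hμ0 _).ne', Real.log_exp, Real.log_pow, Real.log_exp]
    linarith

/-- The stemmed auxiliary sequence `T_m := μ^k t_{m−k}` keeps the lower envelope (constant `cc ≥ 53 + 3 log μ(𝕋)`).
[cite: MadrasSlade1993, Corollary 3.2.5 (3.2.9) and §7.5 (7.5.2)] -/
theorem stem_lower {cc : ℝ} (hcc : 53 + 3 * logMuTri ≤ cc) {k m : ℕ} (hm : k + 4 ≤ m) :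
    Real.exp (-(cc * Real.sqrt m)) * Real.exp logMuTri ^ m ≤
      Real.exp logMuTri ^ k * (triLoopCount (m - k) : ℝ) := by
  have hL : 0 ≤ logMuTri := logMuTri_pos.le
  have hμ0 : 0 < Real.exp logMuTri := Real.exp_pos _
  have h1 := (triLoopCount_envelope (n := m - k) (by omega)).1
  have hcast : ((m - k : ℕ) : ℝ) = (m : ℝ) - k := by rw [Nat.cast_sub (by omega)]
  rw [hcast] at h1
  have hk0 : (0 : ℝ) ≤ k := Nat.cast_nonneg _
  have hsq : Real.sqrt ((m : ℝ) - k) ≤ Real.sqrt m := Real.sqrt_le_sqrt (by linarith)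
  have hcc0 : 0 ≤ cc := by linarith
  have hexp : Real.exp (-(cc * Real.sqrt m)) ≤ Real.exp (-((53 + 3 * logMuTri) * Real.sqrt ((m : ℝ) - k))) := by
    rw [Real.exp_le_exp]
    have := mul_le_mul hcc hsq (Real.sqrt_nonneg _) hcc0
    linarith
  have hpow : Real.exp logMuTri ^ m = Real.exp logMuTri ^ k * Real.exp logMuTri ^ (m - k) := by
    rw [← pow_add]; congr 1; omega
  calc Real.exp (-(cc * Real.sqrt m)) * Real.exp logMuTri ^ m
      ≤ Real.exp (-((53 + 3 * logMuTri) * Real.sqrt ((m : ℝ) - k))) * Real.exp logMuTri ^ m :=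
        mul_le_mul_of_nonneg_right hexp (pow_nonneg hμ0.le _)
    _ = Real.exp logMuTri ^ k *
          (Real.exp (-((53 + 3 * logMuTri) * Real.sqrt ((m : ℝ) - k))) * Real.exp logMuTri ^ (m - k)) := by
        rw [hpow]; ring
    _ ≤ Real.exp logMuTri ^ k * (triLoopCount (m - k) : ℝ) := mul_le_mul_of_nonneg_left h1 (pow_nonneg hμ0.le _)

/-- The stemmed insertion inequality, cast and re-indexed (`T_m := μ^k t_{m−k}`, constant `μ^k · max Z 1`, no stem).
[cite: MadrasSlade1993, §7.5 (7.5.2) and Theorem 3.2.3 (3.2.5)] -/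
theorem stem_ins {S : ℕ → ℕ} {Z k n₁ : ℕ}
    (hins : ∀ n m : ℕ, n₁ ≤ n → 3 ≤ m → S n * triLoopCount m ≤ Z * (n + m + k) ^ 6 * S (n + m + k))
    {n m : ℕ} (hn : n₁ ≤ n) (hm : k + 3 ≤ m) :
    (S n : ℝ) * (Real.exp logMuTri ^ k * triLoopCount (m - k)) ≤
      Real.exp logMuTri ^ k * max (Z : ℝ) 1 * ((n : ℝ) + m) ^ 6 * S (n + m) := by
  have h0 := hins n (m - k) hn (by omega)
  rw [show n + (m - k) + k = n + m by omega] at h0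
  have h1 : (S n : ℝ) * triLoopCount (m - k) ≤ Z * ((n : ℝ) + m) ^ 6 * S (n + m) := by exact_mod_cast h0
  have h2 : (Z : ℝ) * ((n : ℝ) + m) ^ 6 * S (n + m) ≤ max (Z : ℝ) 1 * ((n : ℝ) + m) ^ 6 * S (n + m) :=
    mul_le_mul_of_nonneg_right (mul_le_mul_of_nonneg_right (le_max_left _ _) (by positivity)) (Nat.cast_nonneg _)
  have hμk : 0 ≤ Real.exp logMuTri ^ k := pow_nonneg (Real.exp_pos _).le _
  calc (S n : ℝ) * (Real.exp logMuTri ^ k * triLoopCount (m - k))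
      = Real.exp logMuTri ^ k * ((S n : ℝ) * triLoopCount (m - k)) := by ring
    _ ≤ Real.exp logMuTri ^ k * (max (Z : ℝ) 1 * ((n : ℝ) + m) ^ 6 * S (n + m)) :=
        mul_le_mul_of_nonneg_left (h1.trans h2) hμk
    _ = Real.exp logMuTri ^ k * max (Z : ℝ) 1 * ((n : ℝ) + m) ^ 6 * S (n + m) := by ring

end TriEndpointRate

open TriEndpointRate OneStepRate

/-- **Kesten's mixed rate for `c_N(0,x)` on the triangular lattice, one step, from the polygon insertion** (`x ≠ 0`):
`TriEndpointIns x` gives `K, N₀` with `−K N^{-1/3} ≤ c_{N+1}(0,x)/c_N(0,x) − μ(𝕋) ≤ K N^{-1/4}` for all `N ≥ N₀` — the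
`𝕋`, one-step analogue of Madras–Slade (7.5.2) (`ℤ^d`, two steps, printed).  The abstract engine
`OneStepRate.oneStepRatioRate_insertion` is fed: monotonicity (`A = 4`, `exists_card_triSLx_le_four_mul`), Kesten's
inequality (`kestenIneqTriEndpoint_of`) and the lower envelope (`triEndpointLo_of_ins`) — both from the insertion —, the
Hammersley–Welsh upper envelope (`C = 15`, `triSawCount_le_exp_mul_pow`), and the insertion against `T_m := μ^k t_{m−k}`
with its envelope from `abs_log_triLoopCount_sub_le`.
[cite: MadrasSlade1993, §7.5 eq. (7.5.2) (p. 255); Theorem 7.3.4(b); Corollary 3.2.6] [cite: Kesten1963SAW, Theorem 2] -/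
theorem triEndpointRatioRateMixed_of_ins (x : Site 2) (hx : x ≠ 0)
    (hins : ∃ Z k n₁ : ℕ, ∀ n m : ℕ, n₁ ≤ n → 3 ≤ m →
      #(triSLx n x) * triLoopCount m ≤ Z * (n + m + k) ^ 6 * #(triSLx (n + m + k) x)) :
    ∃ K : ℝ, ∃ N₀ : ℕ, ∀ N : ℕ, N₀ ≤ N →
      -(K * (N : ℝ) ^ (-(1 : ℝ) / 3)) ≤ (#(triSLx (N + 1) x) : ℝ) / #(triSLx N x) - Real.exp logMuTri ∧
        (#(triSLx (N + 1) x) : ℝ) / #(triSLx N x) - Real.exp logMuTri ≤ K * (N : ℝ) ^ (-(1 : ℝ) / 4) := by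
  have hL : 0 ≤ logMuTri := logMuTri_pos.le
  have hμ1 : 1 ≤ Real.exp logMuTri := Real.one_le_exp hL
  have hμ0 : 0 < Real.exp logMuTri := Real.exp_pos _
  obtain ⟨c, hc, N₁, hlo⟩ := triEndpointLo_of_ins x hx hins
  obtain ⟨D, hK⟩ := kestenIneqTriEndpoint_of x hc hlo
  obtain ⟨NK, hNK⟩ := eventually_atTop.1 hK
  obtain ⟨N₀, hmono⟩ := exists_card_triSLx_le_four_mul x
  obtain ⟨Z, k, n₁, hins⟩ := hins
  -- thresholds and constants
  set n₀ : ℕ := max (max N₀ NK) (max N₁ n₁) + 1 with hn₀def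
  have hn₀N₀ : N₀ ≤ n₀ := by omega
  have hn₀NK : NK ≤ n₀ := by omega
  have hn₀N₁ : N₁ ≤ n₀ := by omega
  have hn₀n₁ : n₁ ≤ n₀ := by omega
  have hn₀1 : 1 ≤ n₀ := by omega
  set cc : ℝ := max c (53 + 3 * logMuTri) with hccdef
  have hccc : c ≤ cc := le_max_left _ _
  have hcce : 53 + 3 * logMuTri ≤ cc := le_max_right _ _
  have hcc0 : 0 ≤ cc := hc.trans hccc
  have hP1 : 1 ≤ Real.exp logMuTri ^ k * max (Z : ℝ) 1 :=
    one_le_mul_of_one_le_of_one_le (one_le_pow₀ hμ1) (le_max_right _ _)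
  -- the hypotheses of the abstract engine
  have e_mono : ∀ n : ℕ, n₀ ≤ n → (#(triSLx n x) : ℝ) ≤ 4 * #(triSLx (n + 1) x) := fun n hn => by
    exact_mod_cast hmono n (le_trans hn₀N₀ hn)
  have e_K : ∀ n : ℕ, n₀ ≤ n → ((#(triSLx (n + 1) x) : ℝ) / #(triSLx n x)) ^ 2 - D / n ≤
      ((#(triSLx (n + 1) x) : ℝ) / #(triSLx n x)) * ((#(triSLx (n + 2) x) : ℝ) / #(triSLx (n + 1) x)) :=
    fun n hn => hNK n (le_trans hn₀NK hn)
  have e_lo : ∀ n : ℕ, n₀ ≤ n → Real.exp (-(cc * Real.sqrt n)) * Real.exp logMuTri ^ n ≤ #(triSLx n x) := by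
    intro n hn
    refine le_trans ?_ (hlo n (le_trans hn₀N₁ hn))
    exact mul_le_mul_of_nonneg_right (Real.exp_le_exp.2 (by nlinarith [Real.sqrt_nonneg (n : ℝ)]))
      (pow_nonneg hμ0.le _)
  have e_hi : ∀ n : ℕ, n₀ ≤ n → (#(triSLx n x) : ℝ) ≤ Real.exp (15 * Real.sqrt n) * Real.exp logMuTri ^ n :=
    fun n hn => le_trans (by exact_mod_cast card_triSLx_le_triSawCount n x)
      (triSawCount_le_exp_mul_pow n (le_trans hn₀1 hn))
  have e_T : ∀ m : ℕ, k + 4 ≤ m → Real.exp (-(cc * Real.sqrt m)) * Real.exp logMuTri ^ m ≤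
      Real.exp logMuTri ^ k * (triLoopCount (m - k) : ℝ) := fun m hm => stem_lower hcce hm
  have e_ins : ∀ n m : ℕ, n₀ ≤ n → k + 4 ≤ m →
      (#(triSLx n x) : ℝ) * (Real.exp logMuTri ^ k * triLoopCount (m - k)) ≤
        Real.exp logMuTri ^ k * max (Z : ℝ) 1 * ((n : ℝ) + m) ^ 6 * #(triSLx (n + m) x) :=
    fun n m hn hm => stem_ins (S := fun n => #(triSLx n x)) hins (le_trans hn₀n₁ hn) (by omega)
  obtain ⟨K, M₀, hKM⟩ := oneStepRatioRate_insertion (S := fun n => (#(triSLx n x) : ℝ))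
    (T := fun m => Real.exp logMuTri ^ k * (triLoopCount (m - k) : ℝ)) hμ1 (by norm_num : (1 : ℝ) ≤ 4) hP1 hcc0
    (by norm_num : (0 : ℝ) ≤ 15) hn₀1 e_mono e_K e_lo e_hi e_ins e_T
  exact ⟨K, M₀, fun N hN => hKM N hN⟩

/-- The symmetric `∀ᶠ` corollary: `|c_{N+1}(0,x)/c_N(0,x) − μ(𝕋)| ≤ K N^{-1/4}` eventually (`x ≠ 0`, from the insertion).
[cite: MadrasSlade1993, §7.5 eq. (7.5.2) (p. 255)] -/
theorem abs_card_triSLx_ratio_sub_le_eventually_of_ins (x : Site 2) (hx : x ≠ 0)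
    (hins : ∃ Z k n₁ : ℕ, ∀ n m : ℕ, n₁ ≤ n → 3 ≤ m →
      #(triSLx n x) * triLoopCount m ≤ Z * (n + m + k) ^ 6 * #(triSLx (n + m + k) x)) :
    ∃ K : ℝ, ∀ᶠ N : ℕ in atTop,
      |(#(triSLx (N + 1) x) : ℝ) / #(triSLx N x) - Real.exp logMuTri| ≤ K * (N : ℝ) ^ (-(1 : ℝ) / 4) := by
  obtain ⟨K, N₀, hK⟩ := triEndpointRatioRateMixed_of_ins x hx hins
  refine ⟨max K 0, eventually_atTop.2 ⟨max N₀ 1, fun N hN => ?_⟩⟩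
  have hN1 : (1 : ℝ) ≤ N := by exact_mod_cast le_trans (le_max_right _ _) hN
  obtain ⟨h1, h2⟩ := hK N (le_trans (le_max_left _ _) hN)
  have hp4 : 0 ≤ (N : ℝ) ^ (-(1 : ℝ) / 4) := Real.rpow_nonneg (by linarith) _
  have hp34 : (N : ℝ) ^ (-(1 : ℝ) / 3) ≤ (N : ℝ) ^ (-(1 : ℝ) / 4) :=
    Real.rpow_le_rpow_of_exponent_le hN1 (by norm_num)
  have hK0 : K * (N : ℝ) ^ (-(1 : ℝ) / 4) ≤ max K 0 * (N : ℝ) ^ (-(1 : ℝ) / 4) :=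
    mul_le_mul_of_nonneg_right (le_max_left _ _) hp4
  have hK3 : K * (N : ℝ) ^ (-(1 : ℝ) / 3) ≤ max K 0 * (N : ℝ) ^ (-(1 : ℝ) / 4) := by
    rcases le_or_gt 0 K with hK' | hK'
    · calc K * (N : ℝ) ^ (-(1 : ℝ) / 3) ≤ K * (N : ℝ) ^ (-(1 : ℝ) / 4) := mul_le_mul_of_nonneg_left hp34 hK'
        _ ≤ max K 0 * (N : ℝ) ^ (-(1 : ℝ) / 4) := hK0
    · have : K * (N : ℝ) ^ (-(1 : ℝ) / 3) ≤ 0 :=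
        mul_nonpos_of_nonpos_of_nonneg hK'.le (Real.rpow_nonneg (by linarith) _)
      exact this.trans (mul_nonneg (le_max_right _ _) hp4)
  exact abs_le.2 ⟨by linarith, by linarith⟩

end Literature.Probability.RandomPlanarGeometry.SAW
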